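/-
Copyright (c) 2026 the pub-hodgecm-mathlib formalisation cell (harness21).  Prover seat hodgecm-mathlib-K2E3-p11 (g5), Track B «K2-LIT» ∕ h413
(`stmt-HodgeConjecture-24833`), line `K2_E3_EllipticInputs`, unit U12 §L, Richardson road for (LBGL-ge3) at `N = 3` (road owner K2E3-p11), brick (F-E) =
(LBGL-3E) «THE (2,1)-PARABOLIC SLICE DENSITY OF 𝔤𝔩₃(F)», FILE G″2 «THE LOCAL PULLBACK, LIE SIDE: the `(z, r)`-integral is `c·‖χ(m)‖⁻¹·μ𝔤|_{V_j(m)}`».  2026-09-04.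
-/
import Summits.HodgeConjecture.HodgeConjecture.Theorems.K2E3GL3ParabolicChartBoxes           -- ★ G″1 (this seat): box arithmetic + `setOf_inter_preimage_parabolicChart_eq_box` (brings ★ E″2 `exists_depth_parabolicChart`, ★ E″1 §1 algebra)
import Literature.NumberTheory.Automorphic.AddCharConductorExponent                          -- ★ `primePowBall` kit: `add_mem_∕neg_mem_primePowBall`, `primePowBall_antitone`, `exists_mem_primePowBall`
import Mathlib.MeasureTheory.Measure.Haar.Unique
import HarnessLib

/-!
# K2_E3 road (h413), §L ∕ Richardson road at `N = 3`, brick (F-E) FILE G″2: the local pullback on the Lie side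

Cell `pub/hodgecm-mathlib` (D-0151), Track B, seat K2E3-p11 (g5) (road owner of (F-E) = (LBGL-3E) `sig_K2E3GL3ParabolicSliceDensity`; ROAD v2 on `K2/STATUS.md`,
2026-09-04).  `--supports stmt-HodgeConjecture-24833 --as helper`; THEOREMS ONLY (no definition ∕ instance ∕ notation ∕ named fact ∕ `sorry`); never imports
`Cruxes/…/Lines`.  COUNT-NEUTRAL.

THE POINT.  ROAD v2 computes the (2,1)-parabolic slice `ρ(f) = ∫_K ∫_𝔭 f(Ad(k)P) dP dk` near a `(G,M)`-regular Levi point `M(m) = [[m₀,m₁,0],[m₂,m₃,0],[0,0,m₄]]`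
(`χ(m) = χ_A(m₄) ≠ 0`) by splitting `k = (1 + L z)·p` (`p ∈ K ∩ P`, `z ∈ (𝔭^{j'})²` — brick F″) and absorbing `Ad(p)` into `dP` (★ P″).  What is left is the
`(z, r)`-integral of this file:
  `∫⁻_{z ∈ (𝔭^{j'})²} ∫⁻_{r ∈ F⁷} (1_{V_j(m)}·h)((1 + L z) P(r) (1 + L z)⁻¹) dr dz = c · ‖χ(m)‖_F⁻¹ · ∫⁻_{V_j(m)} h dμ𝔤`      (`j₀(m) ≤ j' ≤ j`)
with `V_j(m) = M(m) + e_m(M₃(𝔭^j))` the image of the depth chart ★ E″2 and ONE constant `c = c(μ𝔤, dx)` (the module between `μ𝔤` and the coordinate measure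
`dz dr`).  Two steps: (i) `(1 + L z) P(r) (1 − L z) = Φ_m(X(z,r))` with `X(z,r) = L z + (P(r) − M(m))`, and `(z, r) ↦ X(z, r) + M(m)` carries `dz ⊗ dr` to `c·μ𝔤`
(Haar uniqueness on `M₃(F)`), so the left side is `c ∫⁻_{T_{j'} ∩ Φ_m⁻¹ V_j(m)} h ∘ Φ_m dμ𝔤`, `T_{j'} = {X | X₂₀, X₂₁ ∈ 𝔭^{j'}}`; (ii) THE SET IDENTITY
`T_{j'} ∩ Φ_m⁻¹(V_j(m)) = M₃(𝔭^j)` for `k₀ + c₀ ≤ j' ≤ j` (valuation bookkeeping: `X_𝔭 = (1 − Lz)(Φ_m X)(1 + Lz) − M(m) ∈ M₃(𝔭^{j'−c₀})`, then injectivity of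
`Φ_m` on `M₃(𝔭^{k₀})` ★ E″2 (a) and `Φ_m(M₃(𝔭^j)) = V_j(m)` ★ E″2 (b)); then ★ E″2 (d) turns `∫⁻_{M₃(𝔭^j)} h ∘ Φ_m` into `‖χ(m)‖⁻¹ ∫⁻_{V_j(m)} h`.
* `parabolicChart_translate_eq` (`Ad(1 + Lz)P(r) = Φ_m(X(z,r))`), `exists_lintegral_pi_pi_eq_mul_lintegral` (the coordinate module `c`), and
  **`exists_lintegral_pi_parabolicChart_indicator_eq`** (the `(z, r)`-integral; the set identity is ★ G″1 `K2E3GL3ParabolicChartBoxes`).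
[HarishChandra1999AdmissibleDistributions, §7 Lemma 7.8] [HarishChandra1970, Part V §4 Lemma 22] [WeilBNT1967, Ch. I §2]
HONEST LABEL: HC_CM is proved only modulo the 7 printed citations (2 remaining named inputs: hLiu418 = stmt-HodgeConjecture-24832, h413 = stmt-HodgeConjecture-24833)
until rung 0 closes; count-neutral helper ((LBGL-ge3)∕(LBGL-3E) NOT ★ here).

## References
* [HarishChandra1999AdmissibleDistributions] Harish-Chandra (DeBacker–Sally), *Admissible Invariant Distributions on Reductive p-adic Groups* (1999), §7, Lemma 7.8.
* [HarishChandra1970] Harish-Chandra (van Dijk), *Harmonic Analysis on Reductive p-adic Groups*, LNM 162 (1970), Part V §4 Lemma 22.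
* [WeilBNT1967] A. Weil, *Basic Number Theory* (1967), Ch. I §2.
-/

set_option autoImplicit false
set_option linter.dupNamespace false

noncomputable section

open MeasureTheory Measure Filter Topology Set Matrix
open scoped MatrixGroups NNReal ENNReal Pointwise
open Literature.NumberTheory.Automorphic Literature.NumberTheory.Automorphic.LocalFieldHaar
open Literature.NumberTheory.GaloisRepresentations Literature.NumberTheory.GaloisRepresentations.IsNonarchimedeanLocalField
open Summit.HodgeConjecture.HodgeConjecture.Cruxes.H413.K2E3GLnMaximalParabolicDescent
open Summit.HodgeConjecture.HodgeConjecture.Cruxes.H413.K2E3GL3ParabolicChartDeriv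
open Summit.HodgeConjecture.HodgeConjecture.Cruxes.H413.K2E3GL3ParabolicOrbitChart

open Summit.HodgeConjecture.HodgeConjecture.Cruxes.H413.K2E3GL3ParabolicChartBoxes

namespace Summit.HodgeConjecture.HodgeConjecture.Cruxes.H413.K2E3GL3ParabolicSliceLocalPullback

/-! ## The `(z, r)`-integral: `∫⁻_{(𝔭^{j'})²} ∫⁻_{F⁷} (1_{V_j(m)}·h)((1 + Lz) P(r) (1 + Lz)⁻¹) = c · ‖χ(m)‖⁻¹ · ∫⁻_{V_j(m)} h dμ𝔤` -/

section Integral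

variable {F : Type*} [Field F] [ValuativeRel F] [TopologicalSpace F] [IsNonarchimedeanLocalField F]
  [MeasurableSpace F] [BorelSpace F]
  [MeasurableSpace (Matrix (Fin 3) (Fin 3) F)] [BorelSpace (Matrix (Fin 3) (Fin 3) F)]

omit [ValuativeRel F] [TopologicalSpace F] [IsNonarchimedeanLocalField F] [MeasurableSpace F] [BorelSpace F]
  [MeasurableSpace (Matrix (Fin 3) (Fin 3) F)] [BorelSpace (Matrix (Fin 3) (Fin 3) F)] in
/-- `(1 + L z)⁻¹ = 1 − L z` (matrix inverse). [folklore] -/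
theorem inv_one_add_lowerRow (z : Fin 2 → F) :
    ((1 : Matrix (Fin 3) (Fin 3) F) + !![0, 0, 0; 0, 0, 0; z 0, z 1, 0])⁻¹ = 1 - !![0, 0, 0; 0, 0, 0; z 0, z 1, 0] :=
  Matrix.inv_eq_right_inv (one_add_lowerRow_mul_one_sub (!![0, 0, 0; 0, 0, 0; z 0, z 1, 0] : Matrix (Fin 3) (Fin 3) F))

omit [ValuativeRel F] [TopologicalSpace F] [IsNonarchimedeanLocalField F] [MeasurableSpace F] [BorelSpace F]
  [MeasurableSpace (Matrix (Fin 3) (Fin 3) F)] [BorelSpace (Matrix (Fin 3) (Fin 3) F)] in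
/-- **`Ad(1 + L z) P(r) = Φ_m(X(z, r))`** with `X(z, r) = L z + (P(r) − M(m))`: the unipotent conjugate of a parabolic element is a value of the parabolic chart.
[cite: HarishChandra1970, Part V §4 Lemma 22] -/
theorem parabolicChart_translate_eq (m : Fin 5 → F) (z : Fin 2 → F) (r : Fin 7 → F) (Φ : Matrix (Fin 3) (Fin 3) F → Matrix (Fin 3) (Fin 3) F)
    (hΦ : Φ = fun X : Matrix (Fin 3) (Fin 3) F =>
        (1 + (!![0, 0, 0; 0, 0, 0; X 2 0, X 2 1, 0] : Matrix (Fin 3) (Fin 3) F)) *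
          (!![m 0, m 1, 0; m 2, m 3, 0; 0, 0, m 4] + !![X 0 0, X 0 1, X 0 2; X 1 0, X 1 1, X 1 2; 0, 0, X 2 2]) *
          (1 - !![0, 0, 0; 0, 0, 0; X 2 0, X 2 1, 0])) :
    Φ !![r 0 - m 0, r 1 - m 1, r 2; r 3 - m 2, r 4 - m 3, r 5; z 0, z 1, r 6 - m 4] =
      (1 + !![0, 0, 0; 0, 0, 0; z 0, z 1, 0]) * !![r 0, r 1, r 2; r 3, r 4, r 5; 0, 0, r 6] * (1 + !![0, 0, 0; 0, 0, 0; z 0, z 1, 0])⁻¹ := by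
  have hP : (!![m 0, m 1, 0; m 2, m 3, 0; 0, 0, m 4] : Matrix (Fin 3) (Fin 3) F) +
      !![(!![r 0 - m 0, r 1 - m 1, r 2; r 3 - m 2, r 4 - m 3, r 5; z 0, z 1, r 6 - m 4] : Matrix (Fin 3) (Fin 3) F) 0 0,
         (!![r 0 - m 0, r 1 - m 1, r 2; r 3 - m 2, r 4 - m 3, r 5; z 0, z 1, r 6 - m 4] : Matrix (Fin 3) (Fin 3) F) 0 1,
         (!![r 0 - m 0, r 1 - m 1, r 2; r 3 - m 2, r 4 - m 3, r 5; z 0, z 1, r 6 - m 4] : Matrix (Fin 3) (Fin 3) F) 0 2;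
         (!![r 0 - m 0, r 1 - m 1, r 2; r 3 - m 2, r 4 - m 3, r 5; z 0, z 1, r 6 - m 4] : Matrix (Fin 3) (Fin 3) F) 1 0,
         (!![r 0 - m 0, r 1 - m 1, r 2; r 3 - m 2, r 4 - m 3, r 5; z 0, z 1, r 6 - m 4] : Matrix (Fin 3) (Fin 3) F) 1 1,
         (!![r 0 - m 0, r 1 - m 1, r 2; r 3 - m 2, r 4 - m 3, r 5; z 0, z 1, r 6 - m 4] : Matrix (Fin 3) (Fin 3) F) 1 2;
         0, 0, (!![r 0 - m 0, r 1 - m 1, r 2; r 3 - m 2, r 4 - m 3, r 5; z 0, z 1, r 6 - m 4] : Matrix (Fin 3) (Fin 3) F) 2 2] =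
      !![r 0, r 1, r 2; r 3, r 4, r 5; 0, 0, r 6] := by
    ext i l; fin_cases i <;> fin_cases l <;> simp
  rw [hΦ, inv_one_add_lowerRow]
  dsimp only
  rw [hP]
  rfl

set_option maxHeartbeats 400000 in -- B47-N3 custody kit (director s1915, 2026-09-04): the Tonelli/uniqueness step sits on a 160k–200k heartbeat cliff
/-- **The coordinate measure vs `μ𝔤`.**  There is ONE `c ∈ (0, ∞)` with `∫⁻_{z ∈ F²} ∫⁻_{r ∈ F⁷} G([[r₀,r₁,r₂],[r₃,r₄,r₅],[z₀,z₁,r₆]]) dr dz = c · ∫⁻ G dμ𝔤` for every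
measurable `G ≥ 0` (Tonelli; the coordinate map is an additive homeomorphism `F² × F⁷ ≃ M₃(F)`, so it carries `dz ⊗ dr` to an additive Haar measure, `= c·μ𝔤` by
uniqueness). [cite: WeilBNT1967, Ch. I §2] -/
theorem exists_lintegral_pi_pi_eq_mul_lintegral (μ𝔤 : Measure (Matrix (Fin 3) (Fin 3) F)) [μ𝔤.IsAddHaarMeasure] (dx : Measure F) [dx.IsAddHaarMeasure] :
    ∃ c : ℝ≥0∞, c ≠ 0 ∧ c ≠ ⊤ ∧ ∀ G : Matrix (Fin 3) (Fin 3) F → ℝ≥0∞, Measurable G →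
      ∫⁻ z : Fin 2 → F, ∫⁻ r : Fin 7 → F, G !![r 0, r 1, r 2; r 3, r 4, r 5; z 0, z 1, r 6] ∂(Measure.pi fun _ : Fin 7 => dx) ∂(Measure.pi fun _ : Fin 2 => dx) =
        c * ∫⁻ Y, G Y ∂μ𝔤 := by
  classical
  haveI : T2Space F := (isLocalField F).toT2Space
  haveI : LocallyCompactSpace F := (isLocalField F).toLocallyCompactSpace
  haveI : SecondCountableTopology F := secondCountableTopology_localField F
  haveI : IsTopologicalRing F := inferInstance
  haveI : LocallyCompactSpace (Matrix (Fin 3) (Fin 3) F) := locallyCompactSpace_matrix (F := F) (m := Fin 3) (n := Fin 3)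
  haveI : SecondCountableTopology (Matrix (Fin 3) (Fin 3) F) := secondCountableTopology_matrix (F := F) (m := Fin 3) (n := Fin 3)
  -- the coordinate isomorphism `T(z, r) = [[r₀,r₁,r₂],[r₃,r₄,r₅],[z₀,z₁,r₆]]`
  let T : ((Fin 2 → F) × (Fin 7 → F)) ≃+ Matrix (Fin 3) (Fin 3) F :=
    { toFun := fun p => !![p.2 0, p.2 1, p.2 2; p.2 3, p.2 4, p.2 5; p.1 0, p.1 1, p.2 6]
      invFun := fun Y => (![Y 2 0, Y 2 1], ![Y 0 0, Y 0 1, Y 0 2, Y 1 0, Y 1 1, Y 1 2, Y 2 2])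
      left_inv := fun p => by
        refine Prod.ext ?_ ?_
        · funext k; fin_cases k <;> rfl
        · funext k; fin_cases k <;> rfl
      right_inv := fun Y => by ext i l; fin_cases i <;> fin_cases l <;> rfl
      map_add' := fun p q => by ext i l; fin_cases i <;> fin_cases l <;> rfl }
  have hTapp : ∀ p : (Fin 2 → F) × (Fin 7 → F), T p = !![p.2 0, p.2 1, p.2 2; p.2 3, p.2 4, p.2 5; p.1 0, p.1 1, p.2 6] := fun p => rfl
  have hTc : Continuous T := by
    change Continuous fun p : (Fin 2 → F) × (Fin 7 → F) => (!![p.2 0, p.2 1, p.2 2; p.2 3, p.2 4, p.2 5; p.1 0, p.1 1, p.2 6] : Matrix (Fin 3) (Fin 3) F)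
    refine continuous_matrix fun i l => ?_
    fin_cases i <;> fin_cases l <;> simp <;> fun_prop
  have hTsc : Continuous T.symm := by
    change Continuous fun Y : Matrix (Fin 3) (Fin 3) F => ((![Y 2 0, Y 2 1] : Fin 2 → F), (![Y 0 0, Y 0 1, Y 0 2, Y 1 0, Y 1 1, Y 1 2, Y 2 2] : Fin 7 → F))
    refine Continuous.prodMk (continuous_pi fun k => ?_) (continuous_pi fun k => ?_)
    · fin_cases k <;> simp <;> fun_prop
    · fin_cases k <;> simp <;> fun_prop
  let Th : ((Fin 2 → F) × (Fin 7 → F)) ≃ₜ Matrix (Fin 3) (Fin 3) F := { T.toEquiv with continuous_toFun := hTc, continuous_invFun := hTsc }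
  let Tm : ((Fin 2 → F) × (Fin 7 → F)) ≃ᵐ Matrix (Fin 3) (Fin 3) F := Th.toMeasurableEquiv
  have hcoe : (Tm : ((Fin 2 → F) × (Fin 7 → F)) → Matrix (Fin 3) (Fin 3) F) = T := funext fun p => rfl
  -- the product measure and its image
  set π : Measure ((Fin 2 → F) × (Fin 7 → F)) := (Measure.pi fun _ : Fin 2 => dx).prod (Measure.pi fun _ : Fin 7 => dx) with hπ
  haveI : π.IsAddHaarMeasure := by rw [hπ]; exact Measure.prod.instIsAddHaarMeasure _ _
  set ν : Measure (Matrix (Fin 3) (Fin 3) F) := π.map T with hν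
  haveI : ν.IsAddHaarMeasure := AddEquiv.isAddHaarMeasure_map (μ := π) T hTc hTsc
  have hνeq : ν = ν.addHaarScalarFactor μ𝔤 • μ𝔤 := isAddLeftInvariant_eq_smul ν μ𝔤
  set c : ℝ≥0 := ν.addHaarScalarFactor μ𝔤 with hc
  refine ⟨(c : ℝ≥0∞), ENNReal.coe_ne_zero.2 (addHaarScalarFactor_pos_of_isAddHaarMeasure ν μ𝔤).ne', ENNReal.coe_ne_top, fun G hG => ?_⟩
  -- Tonelli
  have hgm : Measurable fun p : (Fin 2 → F) × (Fin 7 → F) => G (T p) := hG.comp hTc.measurable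
  have h1 : ∫⁻ z : Fin 2 → F, ∫⁻ r : Fin 7 → F, G !![r 0, r 1, r 2; r 3, r 4, r 5; z 0, z 1, r 6] ∂(Measure.pi fun _ : Fin 7 => dx) ∂(Measure.pi fun _ : Fin 2 => dx) =
      ∫⁻ p, G (T p) ∂π := by
    rw [hπ, lintegral_prod _ hgm.aemeasurable]
    rfl
  -- transport along `T`
  have h2 : ∫⁻ p, G (T p) ∂π = ∫⁻ Y, G Y ∂ν := by
    have h := lintegral_map_equiv (μ := π) G Tm
    rw [hcoe] at h
    rw [hν, h]
  rw [h1, h2, hνeq, lintegral_smul_measure, ENNReal.smul_def, smul_eq_mul]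

/-- **THE `(z, r)`-INTEGRAL (local pullback, Lie side).**  `μ𝔤` an additive Haar measure on `𝔤𝔩₃(F)`, `dx` one on `F`.  There is ONE constant `c ∈ (0, ∞)` (the module between
`μ𝔤` and the coordinate measure `dz ⊗ dr`) such that for every `(G,M)`-regular Levi datum `m` (`χ(m) ≠ 0`) there is a depth `j₀` with: for all `j₀ ≤ j' ≤ j` and every
measurable `h ≥ 0`,
`∫⁻_{z ∈ (𝔭^{j'})²} ∫⁻_{r ∈ F⁷} (1_{V_j(m)}·h)((1 + L z)·P(r)·(1 + L z)⁻¹) dr dz = c · ‖χ(m)‖_F⁻¹ · ∫⁻_{V_j(m)} h dμ𝔤`,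
`V_j(m) = M(m) + e_m(M₃(𝔭^j))` (★ E″2's chart image), `P(r) = [[r₀,r₁,r₂],[r₃,r₄,r₅],[0,0,r₆]]`.  Proof: `parabolicChart_translate_eq`, the coordinate module
`exists_lintegral_pi_pi_eq_mul_lintegral`, translation by `M(m)`, the set identity §2, and ★ E″2 (d).  With brick F″ (`k = (1 + Lz)·p` on the level set
`{k₂₀, k₂₁ ∈ 𝔭^{j'}}`) and ★ P″ this is the main-piece term of `ρ(1_{V_j(m)}·h)`. [cite: HarishChandra1999AdmissibleDistributions, §7 Lemma 7.8]
[cite: HarishChandra1970, Part V §4 Lemma 22] [cite: WeilBNT1967, Ch. I §2] -/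
theorem exists_lintegral_pi_parabolicChart_indicator_eq (μ𝔤 : Measure (Matrix (Fin 3) (Fin 3) F)) [μ𝔤.IsAddHaarMeasure]
    (dx : Measure F) [dx.IsAddHaarMeasure] :
    ∃ c : ℝ≥0∞, c ≠ 0 ∧ c ≠ ⊤ ∧ ∀ m : Fin 5 → F, (!![m 0, m 1; m 2, m 3] : Matrix (Fin 2) (Fin 2) F).charpoly.eval (m 4) ≠ 0 →
      ∃ j₀ : ℕ, ∀ j' j : ℕ, j₀ ≤ j' → j' ≤ j → ∀ h : Matrix (Fin 3) (Fin 3) F → ℝ≥0∞, Measurable h →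
        ∫⁻ z in Set.univ.pi (fun _ : Fin 2 => primePowBall F (j' : ℤ)), ∫⁻ r : Fin 7 → F,
            ((!![m 0, m 1, 0; m 2, m 3, 0; 0, 0, m 4] : Matrix (Fin 3) (Fin 3) F) +ᵥ
              ((fun X : Matrix (Fin 3) (Fin 3) F =>
                  (!![X 0 0, X 0 1, X 0 2; X 1 0, X 1 1, X 1 2; X 2 0 * (m 0 - m 4) + X 2 1 * m 2, X 2 0 * m 1 + X 2 1 * (m 3 - m 4), X 2 2] :
                    Matrix (Fin 3) (Fin 3) F)) '' {X : Matrix (Fin 3) (Fin 3) F | ∀ i l, X i l ∈ primePowBall F j})).indicator h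
              ((1 + !![0, 0, 0; 0, 0, 0; z 0, z 1, 0]) * !![r 0, r 1, r 2; r 3, r 4, r 5; 0, 0, r 6] * (1 + !![0, 0, 0; 0, 0, 0; z 0, z 1, 0])⁻¹)
            ∂(Measure.pi fun _ : Fin 7 => dx) ∂(Measure.pi fun _ : Fin 2 => dx) =
          c * ((normAbs F ((!![m 0, m 1; m 2, m 3] : Matrix (Fin 2) (Fin 2) F).charpoly.eval (m 4)))⁻¹ : ℝ≥0) *
            ∫⁻ X in (!![m 0, m 1, 0; m 2, m 3, 0; 0, 0, m 4] : Matrix (Fin 3) (Fin 3) F) +ᵥ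
              ((fun X : Matrix (Fin 3) (Fin 3) F =>
                  (!![X 0 0, X 0 1, X 0 2; X 1 0, X 1 1, X 1 2; X 2 0 * (m 0 - m 4) + X 2 1 * m 2, X 2 0 * m 1 + X 2 1 * (m 3 - m 4), X 2 2] :
                    Matrix (Fin 3) (Fin 3) F)) '' {X : Matrix (Fin 3) (Fin 3) F | ∀ i l, X i l ∈ primePowBall F j}), h X ∂μ𝔤 := by
  classical
  haveI : T2Space F := (isLocalField F).toT2Space
  haveI : LocallyCompactSpace F := (isLocalField F).toLocallyCompactSpace
  haveI : SecondCountableTopology F := secondCountableTopology_localField F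
  haveI : IsTopologicalRing F := inferInstance
  obtain ⟨c, hc0, hctop, hcG⟩ := exists_lintegral_pi_pi_eq_mul_lintegral (F := F) μ𝔤 dx
  refine ⟨c, hc0, hctop, fun m hm => ?_⟩
  -- ===== the chart data at `m` =====
  obtain ⟨c₀, hc₀⟩ := exists_forall_mem_primePowBall_neg m
  set Φ : Matrix (Fin 3) (Fin 3) F → Matrix (Fin 3) (Fin 3) F := fun X : Matrix (Fin 3) (Fin 3) F =>
    (1 + (!![0, 0, 0; 0, 0, 0; X 2 0, X 2 1, 0] : Matrix (Fin 3) (Fin 3) F)) *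
      (!![m 0, m 1, 0; m 2, m 3, 0; 0, 0, m 4] + !![X 0 0, X 0 1, X 0 2; X 1 0, X 1 1, X 1 2; 0, 0, X 2 2]) *
      (1 - !![0, 0, 0; 0, 0, 0; X 2 0, X 2 1, 0]) with hΦ
  obtain ⟨k₀, hk₀⟩ := exists_depth_parabolicChart m hm μ𝔤 Φ hΦ
  refine ⟨k₀ + c₀, fun j' j hj' hjj h hh => ?_⟩
  obtain ⟨hinj₀, -, -, -, -, -⟩ := hk₀ k₀ le_rfl
  obtain ⟨-, himgj, hopenj, -, -, hlinj⟩ := hk₀ j (by omega)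
  have hΦc : Continuous Φ := by rw [hΦ]; exact continuous_parabolicChart m
  -- names for the sets
  set M₀ : Matrix (Fin 3) (Fin 3) F := !![m 0, m 1, 0; m 2, m 3, 0; 0, 0, m 4] with hM₀
  set V : Set (Matrix (Fin 3) (Fin 3) F) := M₀ +ᵥ ((fun X : Matrix (Fin 3) (Fin 3) F =>
      (!![X 0 0, X 0 1, X 0 2; X 1 0, X 1 1, X 1 2; X 2 0 * (m 0 - m 4) + X 2 1 * m 2, X 2 0 * m 1 + X 2 1 * (m 3 - m 4), X 2 2] :
        Matrix (Fin 3) (Fin 3) F)) '' {X : Matrix (Fin 3) (Fin 3) F | ∀ i l, X i l ∈ primePowBall F j}) with hV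
  set B₂ : Set (Fin 2 → F) := Set.univ.pi (fun _ : Fin 2 => primePowBall F (j' : ℤ)) with hB₂
  set Tset : Set (Matrix (Fin 3) (Fin 3) F) := {X | X 2 0 ∈ primePowBall F (j' : ℤ) ∧ X 2 1 ∈ primePowBall F (j' : ℤ)} with hTset
  have hVopen : IsOpen V := by rw [← himgj]; exact hopenj
  have hVm : MeasurableSet V := hVopen.measurableSet
  have hB₂m : MeasurableSet B₂ := MeasurableSet.univ_pi fun _ => measurableSet_primePowBall (F := F) _
  have hTsetm : MeasurableSet Tset :=
    ((measurableSet_primePowBall (F := F) _).preimage (continuous_id.matrix_elem 2 0).measurable).inter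
      ((measurableSet_primePowBall (F := F) _).preimage (continuous_id.matrix_elem 2 1).measurable)
  -- the set identity (§2)
  have hset : Tset ∩ Φ ⁻¹' V = {X : Matrix (Fin 3) (Fin 3) F | ∀ i l, X i l ∈ primePowBall F j} :=
    setOf_inter_preimage_parabolicChart_eq_box m hc₀ Φ hΦ hinj₀ himgj hj' hjj
  -- ===== (A) the integrand is `(1_V·h) ∘ Φ` at `[[r₀,r₁,r₂],[r₃,r₄,r₅],[z₀,z₁,r₆]] − M₀`, and `z ∈ B₂ ↔ (that matrix) ∈ Tset` =====
  set f : Matrix (Fin 3) (Fin 3) F → ℝ≥0∞ := fun X => V.indicator h (Φ X) with hf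
  have hfm : Measurable f := (hh.indicator hVm).comp hΦc.measurable
  set G : Matrix (Fin 3) (Fin 3) F → ℝ≥0∞ := fun Y => Tset.indicator (fun Y => f (Y - M₀)) Y with hG
  have hGm : Measurable G := (hfm.comp (measurable_id.sub_const M₀)).indicator hTsetm
  have hA : ∀ (z : Fin 2 → F), B₂.indicator (fun z => ∫⁻ r : Fin 7 → F,
      V.indicator h ((1 + !![0, 0, 0; 0, 0, 0; z 0, z 1, 0]) * !![r 0, r 1, r 2; r 3, r 4, r 5; 0, 0, r 6] * (1 + !![0, 0, 0; 0, 0, 0; z 0, z 1, 0])⁻¹)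
        ∂(Measure.pi fun _ : Fin 7 => dx)) z =
      ∫⁻ r : Fin 7 → F, G !![r 0, r 1, r 2; r 3, r 4, r 5; z 0, z 1, r 6] ∂(Measure.pi fun _ : Fin 7 => dx) := by
    intro z
    have hX : ∀ r : Fin 7 → F, (!![r 0, r 1, r 2; r 3, r 4, r 5; z 0, z 1, r 6] : Matrix (Fin 3) (Fin 3) F) - M₀ =
        !![r 0 - m 0, r 1 - m 1, r 2; r 3 - m 2, r 4 - m 3, r 5; z 0, z 1, r 6 - m 4] := fun r => by
      rw [hM₀]; ext i l; fin_cases i <;> fin_cases l <;> simp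
    have hmem : ∀ r : Fin 7 → F, (!![r 0, r 1, r 2; r 3, r 4, r 5; z 0, z 1, r 6] : Matrix (Fin 3) (Fin 3) F) ∈ Tset ↔ z ∈ B₂ := fun r => by
      rw [hTset, hB₂, Set.mem_setOf_eq, Set.mem_univ_pi, Fin.forall_fin_two]
      simp
    by_cases hz : z ∈ B₂
    · rw [Set.indicator_of_mem hz]
      refine lintegral_congr fun r => ?_
      rw [hG]; dsimp only
      rw [Set.indicator_of_mem ((hmem r).2 hz), hX r, hf]
      dsimp only
      rw [parabolicChart_translate_eq m z r Φ hΦ]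
    · rw [Set.indicator_of_notMem hz]
      have h0 : ∀ r : Fin 7 → F, G !![r 0, r 1, r 2; r 3, r 4, r 5; z 0, z 1, r 6] = 0 := fun r => by
        rw [hG]; dsimp only
        exact Set.indicator_of_notMem (fun h' => hz ((hmem r).1 h')) _
      simp only [h0, lintegral_zero]
  rw [← lintegral_indicator hB₂m]
  simp only [hA]
  -- ===== (B) the coordinate module, translation by `M₀` =====
  rw [hcG G hGm, mul_assoc]
  congr 1
  have hD : ∀ Y : Matrix (Fin 3) (Fin 3) F, G Y = Tset.indicator f (Y - M₀) := by
    intro Y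
    have h2 : Y - M₀ ∈ Tset ↔ Y ∈ Tset := by
      rw [hTset, hM₀, Set.mem_setOf_eq, Set.mem_setOf_eq, Matrix.sub_apply, Matrix.sub_apply]
      simp
    by_cases hY : Y ∈ Tset
    · rw [hG]; dsimp only; rw [Set.indicator_of_mem hY, Set.indicator_of_mem (h2.2 hY)]
    · rw [hG]; dsimp only; rw [Set.indicator_of_notMem hY, Set.indicator_of_notMem (mt h2.1 hY)]
  simp only [hD]
  have hE : ∫⁻ Y, Tset.indicator f (Y - M₀) ∂μ𝔤 = ∫⁻ X, Tset.indicator f X ∂μ𝔤 := by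
    simp only [sub_eq_neg_add]
    exact lintegral_add_left_eq_self _ (-M₀)
  rw [hE, lintegral_indicator hTsetm]
  -- ===== (C) `f = 1_{Φ⁻¹V}·(h ∘ Φ)`, the set identity, ★ E″2 (d) =====
  have hfind : f = (Φ ⁻¹' V).indicator (h ∘ Φ) := by rw [hf]; funext X; exact (Set.indicator_comp_right Φ).symm
  rw [hfind, lintegral_indicator (hVm.preimage hΦc.measurable), Measure.restrict_restrict (hVm.preimage hΦc.measurable),
    Set.inter_comm, hset]
  change ∫⁻ X in {X : Matrix (Fin 3) (Fin 3) F | ∀ i l, X i l ∈ primePowBall F j}, h (Φ X) ∂μ𝔤 = _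
  rw [hlinj h hh, himgj]

end Integral

end Summit.HodgeConjecture.HodgeConjecture.Cruxes.H413.K2E3GL3ParabolicSliceLocalPullback

end
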